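import Literature.NumberTheory.EllipticCurves.TateModuleCharpolyRigidity
import Literature.AlgebraicGeometry.Motives.AbelianVarietyFrobeniusCharpoly
import Literature.AlgebraicGeometry.Motives.AbelianVarietyEndDegreeBound
import Literature.NumberTheory.DiophantineGeometry.AVIsogenyTateHoldsProofs
import Literature.NumberTheory.DiophantineGeometry.AVIsogenyTateRationalEquivProofs
import Literature.NumberTheory.DiophantineGeometry.AVKernelHopf
import Literature.NumberTheory.DiophantineGeometry.AVGaloisModuleContinuityProofs
import Literature.AlgebraicGeometry.Motives.AbelianVarietyTorsionCubeProofs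
import HarnessLib

/-!
# The characteristic polynomial of the Frobenius on `T_ℓ A` is an integer polynomial independent of `ℓ`
# (Weil; Mumford §19 Thm. 4, §21; Milne 1986 Thm. 19.1 (a)) — from the theorem of the cube by rigidity

Let `A` be an abelian variety of dimension `g > 0` over a finite field `K` of characteristic `p`, `π` its
Frobenius endomorphism (`AbelianVariety.frobeniusHom`), `A(K̄)` its group of geometric points and
`S_ℓ(F) = {a ∈ A(K̄)[ℓ^∞] | F(π) a = 0}` for `F ∈ ℤ[X]`.  The main theorem of this file,
`AbelianVariety.exists_charpoly_frobenius_package`, produces a monic `P ∈ ℤ[X]` of degree `2g` such that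

* **`charpoly (π | T_ℓ A) = P` for every prime `ℓ ≠ p`** (`exists_charpoly_tateModuleMap_frobeniusHom_eq_map`;
  Mumford, *Abelian Varieties*, §19 Thm. 4 "`P` has integral coefficients independent of `ℓ`" with §21;
  Milne 1986, Thm. 19.1 (a));
* `#S_ℓ(F) = ∏_{P(β) = 0} |F(β)|_ℓ⁻¹` for `ℓ ≠ p` and `F(π)` an isogeny;
* at `p`, the characteristic polynomial `Q_p` of `π` on the `p`-adic Tate module of `A(K̄)` has its roots
  (with multiplicity) among those of `P`, and `#S_p(F) = ∏_{Q_p(γ)=0} |F(γ)|_p⁻¹`.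

The printed proofs (Mumford §19 Thm. 4, Milne Prop. 12.9 / Thm. 19.1) rest on Mumford §19 **Thm. 2** — `deg`
is a polynomial function on `End A`, via intersection numbers `(D^g)` — which the tree does not have (only
the upper bound `kerRank_sum_le_of_cubicalStructure` from the theorem of the cube).  **This file's route
replaces Thm. 2 by the rigidity theorem of `Literature.Algebra.Polynomial.PadicRootMultiplicityRigidity`**
(through its Tate-module form `EllipticCurves/TateModuleCharpolyRigidity`): the KERNEL BOUND
`#S_{ℓ₁}(F) · #S_{ℓ₂}(F) ≤ #Ker F(π)(K̄) ≤ deg F(π) ≤ C(r) · H(F)^{2g}` (`deg F ≤ C H^{2g}` being the cube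
bound for the family `π⁰, …, π^{r-1}`) forces every root of the minimal polynomial of `π` to have one and the
same multiplicity in `charpoly (T_ℓ π)` on each `ℚ`-irreducible factor, independently of `ℓ`.

## Contents (all proved; no definitions, no named facts)

* `CubeFunction.exists_expansion_of_forall` — the quadratic expansion of a cube function with the family
  `g_k` inside a prescribed class (the `eᵢ`, `2eᵢ`, `eᵢ + eⱼ`);
* `AbelianVariety.kerRank_sum_le_of_cubicalStructure_of_isIsogeny`, `kerRank_sum_le_of_isIsogeny` — the
  degree bound of `Motives/AbelianVarietyEndDegreeBound` with "all non-zero endomorphisms are isogenies"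
  weakened to "the `eᵢ`, `2eᵢ`, `eᵢ + eⱼ` are isogenies", and with the cubical structure supplied by the
  (proved) theorem of the cube;
* `AbelianVariety.natCard_kerPoints_le_kerRank` — `#Ker f (L) ≤ deg f` for finite `f` (Dedekind);
* `AbelianVariety.isIsogeny_frobeniusHom` (and powers, doubles, sums `πⁱ + πʲ`),
  `exists_kerRank_aeval_frobeniusHom_le` — **`deg F(π) ≤ C(r) (∑_{i<r} |Fᵢ|)^{2g}`**;
* `AbelianVariety.zsmul_surjective_geomPoints`, `finite_geomTorsion_of_ne_zero`,
  `exists_natCard_geomTorsion_prime_pow` — `A(K̄)` is divisible and **`#A[p^n](K̄) = p^{rn}`** for every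
  prime `p` (some `r`);
* `AbelianVariety.exists_isGoodFamily_of_monic` — distinct irreducible integer factors of a monic `m₀ ∈ ℤ[X]`;
* `AbelianVariety.natCard_setOf_primary_ker_le_kerRank`, `natCard_setOf_primary_ker_mul_le_kerRank`;
* `AbelianVariety.isIsogeny_aeval_frobeniusHom_of_isCoprime` — Bézout: `F(π)` is an isogeny for `F`
  coprime to a polynomial killing `π`;
* `AbelianVariety.exists_isGoodFamily_frobeniusHom`, `exists_charpoly_frobenius_package`,
  `exists_charpoly_tateModuleMap_frobeniusHom_eq_map` — the assembly.

## References

* [MumfordAV1970] D. Mumford, *Abelian Varieties*, TIFR Studies in Mathematics 5 (1970): §6 Cor. 2 and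
  Applications 2–3 (pp. 58–64), §15 (the `p`-rank), §19 Thm. 2–4 (pp. 174–180), §21.
* [Milne1986AbelianVarieties] J. S. Milne, *Abelian Varieties*, in Cornell–Silverman (eds.), *Arithmetic
  Geometry* (1986): §8, §12 (Prop. 12.4, 12.9), §19 Thm. 19.1 (a) (held: `book:cornellnd-arithmetic-geometry`,
  PDF pp. 190–193, 212–213).

## Design

Theorems only.  In the tree (used): `theoremOfCube_linEquiv_holds`, `cubicalStructure_linEquiv_of_theoremOfCube`,
`exists_isAmple_symmetric_of_cube`, the class-map and asymptotic-Riemann–Roch lemmas of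
`Motives/AbelianVarietyEndDegreeBound` (proof copied with the weakened hypothesis), `isIsogeny_zsmul_id_holds`,
`module_finite_hom_holds`, `IsIsogeny.geomPointsMap_surjective`, `Hom.kerPtEquiv`, `natCard_geomTorsion_pow_tate`,
`natCard_setOf_primary_ker_eq`, `isIsogeny_aeval_frobeniusHom`, `TateModule.free/finite_of_card_torsionBy_rank`,
and the rigidity theorems of `TateModuleCharpolyRigidity`.  Mathlib (pin, used): `card_algHom_le_finrank`,
`IsPGroup.iff_card`, `AddSubgroup.card_eq_card_quotient_mul_card_addSubgroup`,
`UniqueFactorizationMonoid.normalizedFactors` (`prod_normalizedFactors`, `Finset.prod_multiset_count`),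
`IsIntegrallyClosed.eq_map_mul_C_of_dvd` (Gauss), `Monic.irreducible_iff_irreducible_map_fraction_map`,
`IsLocalization.integerNormalization_spec`, `Polynomial.map_dvd_map`, `minpoly.monic/aeval`,
`AddCommMonoid.subsingletonIntModule` (for `Module.Finite ℤ (End A)`), `Polynomial.aeval_eq_sum_range'`.
-/

universe u

open CategoryTheory AlgebraicGeometry Filter Topology Asymptotics
open Literature.AlgebraicGeometry.Motives.RatFn

noncomputable section

namespace Literature.AlgebraicGeometry.Motives

/-! ### Cube functions: the expansion family can be taken inside a prescribed class -/

namespace CubeFunction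

open Finset

variable {G Q : Type*} [AddCommGroup G] [AddCommGroup Q] {L : G → Q}

/-- **Quadratic expansion with a controlled family.** `CubeFunction.exists_expansion` with the extra
information that the finite family `g` consists of the `eᵢ`, the `2 eᵢ` and the `eᵢ + eⱼ` (`i ≠ j`): if a
predicate `P` holds on these elements, it holds on every `g_k`. (Same induction; recorded because the
degree bound for endomorphisms needs the `g_k` to be isogenies.) [folklore] -/
theorem exists_expansion_of_forall
    (hcube : ∀ x y z : G, L (x + y + z) + L x + L y + L z = L (x + y) + L (x + z) + L (y + z))
    (h0 : L 0 = 0) (P : G → Prop) (r : ℕ) (e : Fin r → G) (hP1 : ∀ i, P (e i))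
    (hP2 : ∀ i, P ((2 : ℤ) • e i)) (hP3 : ∀ i j, i ≠ j → P (e i + e j)) :
    ∃ (ι : Type) (_ : Fintype ι) (g : ι → G) (c : (Fin r → ℤ) → ι → ℤ) (C₀ : ℕ),
      (∀ k, P (g k)) ∧
      (∀ (n : Fin r → ℤ) (k : ι), |c n k| ≤ C₀ * (1 + ∑ i, |n i|) ^ 2) ∧
      ∀ n : Fin r → ℤ, L (∑ i, n i • e i) = ∑ k, c n k • L (g k) := by
  induction r with
  | zero =>
    refine ⟨Empty, inferInstance, Empty.elim, fun _ k => k.elim, 0, fun k => k.elim, fun _ k => k.elim,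
      fun n => ?_⟩
    simp [h0]
  | succ r ih =>
    obtain ⟨ι, _, g, c, C₀, hgP, hc, hL⟩ := ih (fun i => e i.castSucc) (fun i => hP1 _) (fun i => hP2 _)
      (fun i j hij => hP3 _ _ fun h => hij (Fin.castSucc_injective _ h))
    set u := e (Fin.last r) with hu
    -- the polar identities we need
    let t : ℤ → ℤ := fun a => a * (a - 1) / 2
    -- new family
    let g' : ι ⊕ (Bool ⊕ (Fin r ⊕ Fin r)) → G :=
      Sum.elim g (Sum.elim (fun b => if b then u else (2 : ℤ) • u)
        (Sum.elim (fun i => e i.castSucc + u) (fun i => e i.castSucc)))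
    let c' : (Fin (r + 1) → ℤ) → ι ⊕ (Bool ⊕ (Fin r ⊕ Fin r)) → ℤ := fun n =>
      Sum.elim (c fun i => n i.castSucc)
        (Sum.elim
          (fun b => if b then n (Fin.last r) - 2 * t (n (Fin.last r)) -
              n (Fin.last r) * ∑ i : Fin r, n i.castSucc
            else t (n (Fin.last r)))
          (Sum.elim (fun i => n (Fin.last r) * n i.castSucc)
            (fun i => -(n (Fin.last r) * n i.castSucc))))
    refine ⟨ι ⊕ (Bool ⊕ (Fin r ⊕ Fin r)), inferInstance, g', c', C₀ + 4, ?_, ?_, ?_⟩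
    · -- the class
      rintro (k | (b | (i | i)))
      · exact hgP k
      · cases b
        · exact hP2 (Fin.last r)
        · exact hP1 (Fin.last r)
      · exact hP3 _ _ (Fin.castSucc_lt_last i).ne
      · exact hP1 _
    · -- bounds
      intro n k
      set a := n (Fin.last r) with ha
      set S' := ∑ i : Fin r, |n i.castSucc| with hS'
      set S := ∑ i : Fin (r + 1), |n i| with hS
      have hSS' : S = S' + |a| := by rw [hS, Fin.sum_univ_castSucc]
      have hS'0 : 0 ≤ S' := Finset.sum_nonneg fun i _ => abs_nonneg _
      have ha0 : 0 ≤ |a| := abs_nonneg a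
      have haS : |a| ≤ S := by rw [hSS']; linarith
      have hS'S : S' ≤ S := by rw [hSS']; linarith
      have hS0 : 0 ≤ S := by linarith
      have hsum : |∑ i : Fin r, n i.castSucc| ≤ S' := Finset.abs_sum_le_sum_abs _ _
      have hni : ∀ i : Fin r, |n i.castSucc| ≤ S' := fun i =>
        Finset.single_le_sum (f := fun i => |n i.castSucc|) (fun i _ => abs_nonneg _)
          (Finset.mem_univ i)
      have ht : |t a| ≤ a ^ 2 := abs_tri_le a
      have ha2 : a ^ 2 = |a| ^ 2 := (sq_abs a).symm
      have hC : (C₀ : ℤ) * (1 + S') ^ 2 ≤ (C₀ : ℤ) * (1 + S) ^ 2 := by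
        apply mul_le_mul_of_nonneg_left _ (Nat.cast_nonneg _)
        nlinarith
      have h4 : (4 : ℤ) * (1 + S) ^ 2 ≤ ((C₀ + 4 : ℕ) : ℤ) * (1 + S) ^ 2 := by
        apply mul_le_mul_of_nonneg_right _ (sq_nonneg _)
        push_cast; linarith
      have hC' : (C₀ : ℤ) * (1 + S) ^ 2 ≤ ((C₀ + 4 : ℕ) : ℤ) * (1 + S) ^ 2 := by
        apply mul_le_mul_of_nonneg_right _ (sq_nonneg _)
        push_cast; linarith
      rcases k with k | (b | (i | i))
      · -- old coefficients
        exact ((hc _ k).trans hC).trans hC'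
      · cases b
        · -- `t a`
          change |t a| ≤ _
          refine le_trans ?_ h4
          nlinarith
        · -- `a - 2 t a - a s`
          change |a - 2 * t a - a * ∑ i : Fin r, n i.castSucc| ≤ _
          refine le_trans ?_ h4
          have h1 : |a - 2 * t a - a * ∑ i : Fin r, n i.castSucc| ≤
              |a| + 2 * |t a| + |a| * |∑ i : Fin r, n i.castSucc| := by
            have e1 := abs_sub (a - 2 * t a) (a * ∑ i : Fin r, n i.castSucc)
            have e2 := abs_sub a (2 * t a)
            rw [abs_mul] at e1
            rw [abs_mul, abs_two] at e2
            linarith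
          have h2 : |a| * |∑ i : Fin r, n i.castSucc| ≤ S * S :=
            mul_le_mul haS (hsum.trans hS'S) (abs_nonneg _) hS0
          nlinarith
      · change |a * n i.castSucc| ≤ _
        refine le_trans ?_ h4
        rw [abs_mul]
        have := mul_le_mul haS ((hni i).trans hS'S) (abs_nonneg _) hS0
        nlinarith
      · change |-(a * n i.castSucc)| ≤ _
        refine le_trans ?_ h4
        rw [abs_neg, abs_mul]
        have := mul_le_mul haS ((hni i).trans hS'S) (abs_nonneg _) hS0
        nlinarith
    · -- the identity
      intro n
      set a := n (Fin.last r) with ha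
      set f' := ∑ i : Fin r, n i.castSucc • e i.castSucc with hf'
      have hsplit : ∑ i : Fin (r + 1), n i • e i = f' + a • u := by
        rw [Fin.sum_univ_castSucc]
      have hB1 : L (f' + a • u) - L f' - L (a • u) = a • (L (f' + u) - L f' - L u) :=
        polar_zsmul_right hcube h0 a f' u
      have hB2 : L (f' + u) - L f' - L u =
          ∑ i : Fin r, (L (n i.castSucc • e i.castSucc + u) - L (n i.castSucc • e i.castSucc) - L u) := by
        rw [hf']; exact polar_sum_left _ hcube h0 _ u
      have hB3 : ∀ i : Fin r, L (n i.castSucc • e i.castSucc + u) - L (n i.castSucc • e i.castSucc) - L u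
          = n i.castSucc • (L (e i.castSucc + u) - L (e i.castSucc) - L u) := fun i =>
        polar_zsmul_left hcube h0 _ _ u
      have hLa : L (a • u) = a • L u + t a • (L ((2 : ℤ) • u) - (2 : ℤ) • L u) :=
        apply_zsmul hcube h0 a u
      have hLf' : L f' = ∑ k, c (fun i => n i.castSucc) k • L (g k) := hL _
      rw [hsplit]
      have e1 : L (f' + a • u) = L f' + L (a • u) + a • (L (f' + u) - L f' - L u) := by
        rw [← hB1]; abel
      rw [e1, hB2, Finset.sum_congr rfl fun i _ => hB3 i, hLa, hLf']
      simp only [Fintype.sum_sum_type, Fintype.sum_bool, g', c', Sum.elim_inl, Sum.elim_inr,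
        if_true, if_false, Bool.false_eq_true]
      simp only [smul_sub, Finset.smul_sum, Finset.sum_sub_distrib, sub_smul, neg_smul,
        Finset.sum_neg_distrib, smul_smul]
      rw [← Finset.sum_smul, ← Finset.mul_sum]
      module

end CubeFunction

namespace AbelianVariety

open scoped MonObj

variable {K : Type u} [Field K]

/-! ### The degree bound for a family of isogenies whose pairwise sums and doubles are isogenies -/

open Classical in
/-- **The polynomial degree bound for integer combinations of a family of endomorphisms** — the variant of
`kerRank_sum_le_of_cubicalStructure` in which the hypothesis "every non-zero endomorphism of `X` is an
isogeny" is replaced by: the `eᵢ`, the `2 eᵢ` and the `eᵢ + eⱼ` (`i ≠ j`) are isogenies (which is all the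
proof uses, through `CubeFunction.exists_expansion_of_forall`).  Conclusion as there: with the cubical
structure and an ample divisor on `X` of dimension `g > 0`, `deg (∑ nᵢ eᵢ) ≤ C (∑ |nᵢ|)^{2g}` for all
`n ∈ ℤ^r` (`deg` = `Hom.kerRank` on isogenies, `0` otherwise).  Proof verbatim as in
`Motives/AbelianVarietyEndDegreeBound` (Mumford §6 Cor. 2, asymptotic Riemann–Roch).
[cite: MumfordAV1970, §19 Thm. 2 (p. 174) and §6 Cor. 2 (p. 58)] -/
theorem kerRank_sum_le_of_cubicalStructure_of_isIsogeny (X : AbelianVariety K)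
    (hcs : cubicalStructure_linEquiv X) (hamp : ∃ D : CartierDivisor X.X.left, D.IsAmple)
    (hX : 0 < X.dim) (r : ℕ) (e : Fin r → (X ⟶ X)) (he1 : ∀ i, IsIsogeny (e i))
    (he2 : ∀ i, IsIsogeny ((2 : ℤ) • e i)) (he3 : ∀ i j, i ≠ j → IsIsogeny (e i + e j)) :
    ∃ C : ℤ, ∀ n : Fin r → ℤ,
      (if IsIsogeny (∑ i, n i • e i) then (Hom.kerRank (∑ i, n i • e i) : ℤ) else 0) ≤
        C * (∑ i, |n i|) ^ (2 * X.dim) := by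
  classical
  -- a class map
  obtain ⟨Q, _, cl, hadd, heq⟩ := CartierDivisor.exists_classMap X.X.left
  -- an effective ample divisor
  obtain ⟨D₀, hD₀⟩ := hamp
  obtain ⟨D, hD, hDeff⟩ := hD₀.exists_isAmple_isEffective
  -- the quadratic map `L φ = [φ^* D]`
  set L : (X ⟶ X) → Q := fun φ => cl (D.classPullback (Hom.toSchemeHom φ)) with hLdef
  have h0L : L 0 = 0 := classMap_classPullback_zero hadd heq D
  have hcubeL : ∀ x y z : X ⟶ X,
      L (x + y + z) + L x + L y + L z = L (x + y) + L (x + z) + L (y + z) :=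
    fun x y z => classMap_classPullback_cube hadd heq hcs D x y z
  obtain ⟨J, _, g, c, C₀, hgP, hc, hL⟩ :=
    CubeFunction.exists_expansion_of_forall hcubeL h0L (fun φ => IsIsogeny φ) r e he1 he2 he3
  -- the non-zero members of the family and their pullback divisors
  have hgi : ∀ k : {k : J // g k ≠ 0}, IsIsogeny (g k) := fun k => hgP k
  let G : {k : J // g k ≠ 0} → CartierDivisor X.X.left := fun k =>
    haveI := (hgi k).1
    D.pullback (Hom.toSchemeHom (g (k : J)))
  have hGeff : ∀ k, (G k).IsEffective := fun k => by
    haveI := (hgi k).1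
    exact hDeff.pullback _
  have hGamp : ∀ k, (G k).IsAmple := fun k => by
    haveI := (hgi k).1
    haveI := (hgi k).2
    exact hD.pullback _
  have hGcl : ∀ k, cl (G k) = L (g k) := fun k => by
    haveI := (hgi k).1
    exact ((heq _ _).1 (CartierDivisor.classPullback_linEquiv_pullback _ D)).symm
  -- an ample `H` with `[H] = [D] + ∑ [G k]`
  obtain ⟨H, hH, hclH⟩ :=
    CartierDivisor.exists_isAmple_classMap_eq_add_sum hadd Finset.univ hD G fun k _ => hGamp k
  -- asymptotic Riemann–Roch for `D` and `H`
  haveI : IsProper (X.X.left ↘ Spec (.of K)) := X.isProper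
  obtain ⟨δ, hδ, hD1⟩ := CartierDivisor.asymptoticRiemannRoch_of_isAmple_holds K X.X.left D hD
  obtain ⟨δH, hδH, hH1⟩ := CartierDivisor.asymptoticRiemannRoch_of_isAmple_holds K X.X.left H hH
  set d := X.dim with hd
  have hdim : schemeDim X.X.left = d := rfl
  -- the constant
  refine ⟨(δH : ℤ) * ((4 * C₀ + 1 : ℕ) : ℤ) ^ d, fun n => ?_⟩
  set f := ∑ i, n i • e i with hf
  set S : ℕ := ∑ i, (n i).natAbs with hS
  have hSint : (∑ i, |n i| : ℤ) = S := by rw [hS]; push_cast; rfl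
  by_cases hfi : IsIsogeny f
  swap
  · rw [if_neg hfi]; positivity
  rw [if_pos hfi, hSint]
  -- `f ≠ 0`, so `S ≥ 1`
  have hf0 : f ≠ 0 := fun h => not_isIsogeny_zero_of_dim_pos hX (h ▸ hfi)
  have hS1 : 1 ≤ S := by
    by_contra hlt
    have hS0 : S = 0 := by omega
    apply hf0
    rw [hf]
    refine Finset.sum_eq_zero fun i _ => ?_
    have h1 : (n i).natAbs = 0 := Finset.sum_eq_zero_iff.1 hS0 i (Finset.mem_univ _)
    rw [Int.natAbs_eq_zero.1 h1, zero_smul]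
  -- the size of the coefficients
  set M : ℕ := C₀ * (1 + S) ^ 2 + 1 with hM
  have hM0 : 0 < M := Nat.succ_pos _
  have hcM : ∀ k, |c n k| < M := fun k => by
    have h1 := hc n k
    rw [hSint] at h1
    have h2 : (C₀ : ℤ) * (1 + (S : ℤ)) ^ 2 < M := by rw [hM]; push_cast; linarith
    exact lt_of_le_of_lt h1 h2
  let cp : {k : J // g k ≠ 0} → ℕ := fun k => (c n k).toNat
  let cm : {k : J // g k ≠ 0} → ℕ := fun k => (-c n k).toNat
  have hcpM : ∀ k, cp k ≤ M := fun k => by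
    have h1 := hcM k
    have h2 : ((c n k).toNat : ℤ) ≤ M := by
      rcases le_or_gt 0 (c n k) with h | h
      · rw [Int.toNat_of_nonneg h]; exact (le_abs_self _).trans h1.le
      · rw [Int.toNat_eq_zero.2 h.le]; positivity
    exact_mod_cast h2
  -- identity in `Q`: `L f + ∑ cm • [G] = ∑ cp • [G]`
  have hLf : L f = ∑ k : {k : J // g k ≠ 0}, c n k • cl (G k) := by
    rw [hf, hL n, ← Fintype.sum_subtype_add_sum_subtype (fun k => g k ≠ 0)]
    have hz : ∑ k : {k : J // ¬ g k ≠ 0}, c n k • L (g k) = 0 :=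
      Finset.sum_eq_zero fun k _ => by
        have hk : g k = 0 := not_not.1 k.2
        rw [hk, h0L, smul_zero]
    rw [hz, add_zero]
    exact Finset.sum_congr rfl fun k _ => by rw [hGcl]
  have hident : L f + ∑ k, cm k • cl (G k) = ∑ k, cp k • cl (G k) := by
    rw [hLf, ← Finset.sum_add_distrib]
    refine Finset.sum_congr rfl fun k _ => ?_
    rw [← natCast_zsmul _ (cm k), ← natCast_zsmul _ (cp k), ← add_smul]
    congr 1
    have := Int.toNat_sub_toNat_neg (c n k)
    simp only [cp, cm]
    linarith
  -- effective representatives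
  obtain ⟨Ep, -, hclEp⟩ :=
    CartierDivisor.exists_isEffective_classMap_eq_sum hadd heq Finset.univ cp G fun k _ => hGeff k
  obtain ⟨Em, hEm, hclEm⟩ :=
    CartierDivisor.exists_isEffective_classMap_eq_sum hadd heq Finset.univ cm G fun k _ => hGeff k
  obtain ⟨Rm, hRm, hclRm⟩ :=
    CartierDivisor.exists_isEffective_classMap_eq_sum hadd heq Finset.univ (fun k => M - cp k) G
      fun k _ => hGeff k
  -- the pullback `f^* D`
  haveI : Surjective (Hom.toSchemeHom f) := hfi.1
  haveI : IsFinite (Hom.toSchemeHom f) := hfi.2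
  haveI : Flat (Hom.toSchemeHom f) := IsIsogeny.flat_toSchemeHom_holds hfi
  set Df := D.pullback (Hom.toSchemeHom f) with hDf
  have hclDf : cl Df = L f :=
    (heq _ _).1 (CartierDivisor.classPullback_linEquiv_pullback _ D).symm
  -- the three class identities
  have hA1 : cl (Df + Em) = cl Df + cl Em := hadd _ _
  have hA2 : cl (Df + Em) = cl Ep := by rw [hadd, hclDf, hclEm, hclEp]; exact hident
  have hA3 : cl (M • H) = cl Ep + cl (M • D + Rm) := by
    rw [CartierDivisor.classMap_smul hadd heq, hclH, hadd,
      CartierDivisor.classMap_smul hadd heq, hclEp, hclRm, smul_add, Finset.smul_sum,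
      add_left_comm, ← Finset.sum_add_distrib]
    congr 1
    refine Finset.sum_congr rfl fun k _ => ?_
    rw [← add_smul, Nat.add_sub_cancel' (hcpM k)]
  -- embeddings of sections for every `m`
  have hinj : ∀ m : ℕ, ∃ φ : (m • Df).sections K →ₗ[K] (m • (M • H)).sections K,
      Function.Injective φ := fun m => by
    obtain ⟨φ₁, hφ₁⟩ :=
      CartierDivisor.exists_injective_of_classMap_eq_add hadd heq K hA1 hEm m
    obtain ⟨e₂⟩ := CartierDivisor.nonempty_sectionsEquiv_of_linEquiv K
      (((heq _ _).2 hA2).smul m)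
    obtain ⟨φ₃, hφ₃⟩ := CartierDivisor.exists_injective_of_classMap_eq_add hadd heq K hA3
      ((hDeff.smul M).add hRm) m
    exact ⟨φ₃.comp (e₂.toLinearMap.comp φ₁), hφ₃.comp (e₂.injective.comp hφ₁)⟩
  -- asymptotics of `f^* D`
  set rk := Hom.kerRank f with hrk
  have hr : ∀ y, (Hom.toSchemeHom f).finrank y = rk := hfi.finrank_eq_kerRank
  have hD2 := CartierDivisor.hasAsympDegree_pullback_of_facts
    CartierDivisor.asymptoticRiemannRoch_of_isAmple_holds CartierDivisor.asympDegree_pullback_eq_holds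
    (Hom.toSchemeHom f) rk hr hD hD1
  rw [hdim] at hD1 hD2 hH1
  have key : rk * δ ≤ δH * M ^ d :=
    CartierDivisor.le_of_injective_sections K hD2 hH1 hδH hM0 (Eventually.of_forall hinj)
  -- arithmetic
  have hS2 : 1 ≤ S ^ 2 := Nat.one_le_pow _ _ hS1
  have h4 : (1 + S) ^ 2 ≤ 4 * S ^ 2 := by nlinarith
  have hMS : M ≤ (4 * C₀ + 1) * S ^ 2 :=
    calc M = C₀ * (1 + S) ^ 2 + 1 := rfl
      _ ≤ C₀ * (4 * S ^ 2) + S ^ 2 := add_le_add (Nat.mul_le_mul_left _ h4) hS2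
      _ = (4 * C₀ + 1) * S ^ 2 := by ring
  have h1 : rk ≤ δH * ((4 * C₀ + 1) * S ^ 2) ^ d :=
    calc rk ≤ rk * δ := Nat.le_mul_of_pos_right rk hδ
      _ ≤ δH * M ^ d := key
      _ ≤ δH * ((4 * C₀ + 1) * S ^ 2) ^ d :=
        Nat.mul_le_mul_left _ (Nat.pow_le_pow_left hMS d)
  rw [mul_pow, ← mul_assoc] at h1
  rw [pow_mul]
  exact_mod_cast h1

open Classical in
/-- **The degree bound from the Theorem of the Cube (now a theorem of the tree), for a family of isogenies
with isogenous doubles and pairwise sums**: `deg (∑ nᵢ eᵢ) ≤ C_e (∑ |nᵢ|)^{2 dim X}` — hypothesis-free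
apart from the family (`theoremOfCube_linEquiv_holds`, `cubicalStructure_linEquiv_of_theoremOfCube`,
`exists_isAmple_symmetric_of_cube`). [cite: MumfordAV1970, §19 Thm. 2 (p. 174) and §6 Cor. 2 (p. 58)] -/
theorem kerRank_sum_le_of_isIsogeny (X : AbelianVariety K) (hX : 0 < X.dim) (r : ℕ)
    (e : Fin r → (X ⟶ X)) (he1 : ∀ i, IsIsogeny (e i)) (he2 : ∀ i, IsIsogeny ((2 : ℤ) • e i))
    (he3 : ∀ i j, i ≠ j → IsIsogeny (e i + e j)) :
    ∃ C : ℤ, ∀ n : Fin r → ℤ,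
      (if IsIsogeny (∑ i, n i • e i) then (Hom.kerRank (∑ i, n i • e i) : ℤ) else 0) ≤
        C * (∑ i, |n i|) ^ (2 * X.dim) := by
  obtain ⟨D, hD, -⟩ := X.exists_isAmple_symmetric_of_cube theoremOfCube_linEquiv_holds
  exact kerRank_sum_le_of_cubicalStructure_of_isIsogeny X
    (X.cubicalStructure_linEquiv_of_theoremOfCube theoremOfCube_linEquiv_holds) ⟨D, hD⟩ hX r e he1 he2 he3

/-! ### Kernels on geometric points: finiteness and the bound `#Ker f (K̄) ≤ deg f` -/

section KerPoints

variable {A B : AbelianVariety K} (f : A ⟶ B) [IsFinite (Hom.toSchemeHom f)]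
  (L : Type u) [Field L] [Algebra K L]

/-- The `L`-points of the kernel of a finite homomorphism form a finite group
(`Ker f (L) = Hom_K(Γ(Ker f, 𝒪), L)`, `Hom.kerPtEquiv`, and Mathlib `Finite.algHom`). [folklore] -/
theorem finite_kerPoints_of_isFinite : Finite (Hom.kerPoints (specOver K L) f) :=
  Finite.of_equiv _ (Hom.kerPtEquiv f L).symm

/-- **`#Ker f (L) ≤ deg f`** for a finite homomorphism `f` and any field `L ⊇ K`: the `L`-points of
`Ker f` are the `K`-algebra maps `Γ(Ker f, 𝒪) → L` (`Hom.kerPtEquiv`), which are `L`-linearly independent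
(Dedekind; Mathlib `card_algHom_le_finrank`), and `deg f = dim_K Γ(Ker f, 𝒪)` (`Hom.finrank_kerAlg_eq_kerRank`).
(Equality holds for étale `f` and separably closed `L`, `natCard_kerPoints_eq_kerRank`.) [folklore] -/
theorem natCard_kerPoints_le_kerRank : Nat.card (Hom.kerPoints (specOver K L) f) ≤ Hom.kerRank f := by
  rw [Nat.card_congr (Hom.kerPtEquiv f L), ← Hom.finrank_kerAlg_eq_kerRank]
  exact card_algHom_le_finrank K (Hom.KerAlg f) L

end KerPoints

/-! ### The Frobenius and its powers are isogenies -/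

section Frobenius

variable [Finite K] (A : AbelianVariety K)

/-- The Frobenius endomorphism is surjective (it is the identity on the underlying space). [folklore] -/
theorem surjective_toSchemeHom_frobeniusHom : Surjective (Hom.toSchemeHom (frobeniusHom A)) := by
  refine ⟨?_⟩
  rw [toSchemeHom_frobeniusHom, powEndo_base]
  intro x
  exact ⟨x, rfl⟩

/-- **The Frobenius endomorphism `π` of an abelian variety over a finite field is an isogeny** (surjective,
hence finite: `isIsogeny_of_surjective_end`). [cite: MumfordAV1970, §21] -/
theorem isIsogeny_frobeniusHom : IsIsogeny (frobeniusHom A) := by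
  haveI := surjective_toSchemeHom_frobeniusHom A
  exact isIsogeny_of_surjective_end _

/-- The powers `π^i` are isogenies. [folklore] -/
theorem isIsogeny_frobeniusHom_pow (i : ℕ) : IsIsogeny ((End.of (frobeniusHom A) ^ i : End A) : A ⟶ A) := by
  induction i with
  | zero => rw [pow_zero]; exact isIsogeny_id A
  | succ i ih =>
    rw [pow_succ, End.mul_def]
    exact isIsogeny_comp (isIsogeny_frobeniusHom A) ih

/-- `2 π^i = π^i ≫ [2]` is an isogeny. [folklore] -/
theorem isIsogeny_two_zsmul_frobeniusHom_pow (i : ℕ) :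
    IsIsogeny ((2 : ℤ) • ((End.of (frobeniusHom A) ^ i : End A) : A ⟶ A)) := by
  have h : (2 : ℤ) • ((End.of (frobeniusHom A) ^ i : End A) : A ⟶ A) =
      ((End.of (frobeniusHom A) ^ i : End A) : A ⟶ A) ≫ ((2 : ℤ) • 𝟙 A) := by
    rw [Preadditive.comp_zsmul, Category.comp_id]; rfl
  rw [h]
  exact isIsogeny_comp (isIsogeny_frobeniusHom_pow A i) (isIsogeny_zsmul_id_holds A 2 two_ne_zero)

/-- `π^i + π^j = π^i (1 + π^{j-i})` (`i < j`) is an isogeny: `1 + π^k` (`k ≥ 1`) is an étale isogeny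
(`isIsogeny_aeval_frobeniusHom`). [folklore] -/
theorem isIsogeny_frobeniusHom_pow_add {i j : ℕ} (hij : i ≠ j) :
    IsIsogeny (((End.of (frobeniusHom A) ^ i : End A) : A ⟶ A) + ((End.of (frobeniusHom A) ^ j : End A) : A ⟶ A)) := by
  -- reduce to `i < j`
  wlog hlt : i < j generalizing i j
  · rw [add_comm]; exact this hij.symm (lt_of_le_of_ne (not_lt.mp hlt) hij.symm)
  obtain ⟨k, rfl⟩ := Nat.exists_eq_add_of_lt hlt
  set π := End.of (frobeniusHom A) with hπ
  have hk : IsIsogeny ((Polynomial.aeval π (1 + Polynomial.X ^ (k + 1) : Polynomial ℤ) : End A) : A ⟶ A) := by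
    refine isIsogeny_aeval_frobeniusHom _ ?_
    rw [Polynomial.coeff_add, Polynomial.coeff_one_zero, Polynomial.coeff_X_pow, if_neg (Nat.succ_ne_zero k).symm,
      add_zero, Int.cast_one]
    exact one_ne_zero
  have h : ((π ^ i : End A) : A ⟶ A) + ((π ^ (i + k + 1) : End A) : A ⟶ A) =
      ((Polynomial.aeval π (1 + Polynomial.X ^ (k + 1) : Polynomial ℤ) : End A) : A ⟶ A) ≫ ((π ^ i : End A) : A ⟶ A) := by
    rw [← End.mul_def, map_add, map_one, map_pow, Polynomial.aeval_X, mul_add, mul_one, ← pow_add]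
    congr 2
  rw [h]
  exact isIsogeny_comp hk (isIsogeny_frobeniusHom_pow A i)

/-- **The degree bound on `ℤ[π]`** (Mumford §19 Thm. 2 in the form of an upper bound, from the theorem
of the cube): for every `r` there is `C` with `deg F(π) ≤ C (∑_{i<r} |Fᵢ|)^{2 dim A}` for all integer
polynomials `F` of degree `< r` with `F(π)` an isogeny (`kerRank_sum_le_of_isIsogeny` for the family
`π⁰, …, π^{r-1}`, whose members, doubles and pairwise sums are isogenies). [cite: MumfordAV1970, §19 Thm. 2 (p. 174)] -/
theorem exists_kerRank_aeval_frobeniusHom_le (hA : 0 < A.dim) (r : ℕ) :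
    ∃ C : ℤ, ∀ F : Polynomial ℤ, F.natDegree < r →
      IsIsogeny ((Polynomial.aeval (End.of (frobeniusHom A)) F : End A) : A ⟶ A) →
        (Hom.kerRank ((Polynomial.aeval (End.of (frobeniusHom A)) F : End A) : A ⟶ A) : ℤ) ≤
          C * (∑ i ∈ Finset.range r, |F.coeff i|) ^ (2 * A.dim) := by
  classical
  set e : Fin r → (A ⟶ A) := fun i => ((End.of (frobeniusHom A) ^ (i : ℕ) : End A) : A ⟶ A) with he
  obtain ⟨C, hC⟩ := kerRank_sum_le_of_isIsogeny A hA r e (fun i => isIsogeny_frobeniusHom_pow A i)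
    (fun i => isIsogeny_two_zsmul_frobeniusHom_pow A i)
    (fun i j hij => isIsogeny_frobeniusHom_pow_add A fun h => hij (Fin.ext h))
  refine ⟨C, fun F hF hiso => ?_⟩
  have hsum : (∑ i : Fin r, F.coeff i • e i) =
      ((Polynomial.aeval (End.of (frobeniusHom A)) F : End A) : A ⟶ A) := by
    rw [Polynomial.aeval_eq_sum_range' hF, Finset.sum_range]
    rfl
  have h := hC fun i => F.coeff i
  rw [hsum, if_pos hiso] at h
  rwa [Finset.sum_range fun i => |F.coeff i|]

end Frobenius

/-! ### Torsion of geometric points at an arbitrary prime: `#A[p^n](K̄) = p^{rn}` -/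

section PTorsion

open AddSubgroup Hom Literature.NumberTheory.DiophantineGeometry

variable (A : AbelianVariety K)

/-- `[n]_A` acts on geometric points as multiplication by `n`. [folklore] -/
theorem geomPointsMap_zsmul_id (n : ℤ) : geomPointsMap (n • 𝟙 A) = n • AddMonoidHom.id A.geomPoints := by
  rw [← Hom.geomPointsMapAddMonoidHom_apply, map_zsmul, Hom.geomPointsMapAddMonoidHom_apply, geomPointsMap_id]

/-- **`A(K̄)` is divisible**: multiplication by `n ≠ 0` is onto, `[n]_A` being an isogeny
(`isIsogeny_zsmul_id_holds`, `IsIsogeny.geomPointsMap_surjective`). [cite: MumfordAV1970, §6 Application 2 (p. 62)] -/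
theorem zsmul_surjective_geomPoints {n : ℤ} (hn : n ≠ 0) :
    Function.Surjective fun a : A.geomPoints => n • a := by
  intro b
  obtain ⟨a, ha⟩ := (isIsogeny_zsmul_id_holds A n hn).geomPointsMap_surjective b
  refine ⟨a, ?_⟩
  rw [geomPointsMap_zsmul_id] at ha
  simpa using ha

/-- `A[n](K̄)` is finite for every `n ≠ 0` (also for `n` divisible by the characteristic): `[n]_A` is an
isogeny. [cite: MumfordAV1970, §6 Application 3 (Proposition p. 64)] -/
theorem finite_geomTorsion_of_ne_zero {n : ℤ} (hn : n ≠ 0) : Finite (A.geomTorsion n) :=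
  haveI := finite_torsionPoints_of_isIsogeny_zsmul (isIsogeny_zsmul_id_holds A n hn) (AlgebraicClosure K)
  Finite.of_equiv _ (A.geomTorsionEquiv n).symm

/-- **`#A[p^n](K̄) = p^{rn}` for every prime `p`** (including `p = char K`), for some `r = r(A, p) ≥ 0`:
`A[p](K̄)` is a finite group of exponent `p`, of order `p^r` say, and multiplication by `p^n` maps
`A[p^{n+1}](K̄)` onto `A[p](K̄)` (divisibility of `A(K̄)`) with kernel `A[p^n](K̄)`.  (For `p ≠ char K`,
`r = 2 dim A`; for `p = char K`, `r` is the `p`-rank.) [cite: MumfordAV1970, §6 Application 2 (p. 62) and §15 (p. 147, the `p`-rank)] -/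
theorem exists_natCard_geomTorsion_prime_pow (p : ℕ) [hp : Fact p.Prime] :
    ∃ r : ℕ, ∀ n : ℕ, Nat.card (torsionBy A.geomPoints (p ^ n : ℕ)) = p ^ (r * n) := by
  have hp0 : (p : ℤ) ≠ 0 := by exact_mod_cast hp.out.ne_zero
  haveI hfin : Finite (torsionBy A.geomPoints ((p : ℕ) : ℤ)) := finite_geomTorsion_of_ne_zero A hp0
  -- `#A[p](K̄) = p^r`
  obtain ⟨r, hr⟩ : ∃ r : ℕ, Nat.card (torsionBy A.geomPoints ((p : ℕ) : ℤ)) = p ^ r := by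
    have hG : IsPGroup p (Multiplicative (torsionBy A.geomPoints ((p : ℕ) : ℤ))) := by
      intro x
      refine ⟨1, ?_⟩
      rw [pow_one]
      apply Multiplicative.toAdd.injective
      rw [toAdd_pow, toAdd_one]
      exact torsionBy.nsmul (Multiplicative.toAdd x)
    obtain ⟨r, hr⟩ := IsPGroup.iff_card.mp hG
    exact ⟨r, by rw [← hr]; exact (Nat.card_congr Multiplicative.toAdd).symm⟩
  refine ⟨r, fun n => ?_⟩
  induction n with
  | zero =>
    rw [mul_zero, pow_zero]
    have h1 : torsionBy A.geomPoints ((1 : ℕ) : ℤ) = ⊥ := by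
      ext x
      rw [torsionBy.nsmul_iff, one_smul, AddSubgroup.mem_bot]
    rw [h1, AddSubgroup.card_bot]
  | succ n ih =>
    -- `ψ = [p^n] : A[p^{n+1}] → A[p]`
    let ψ : torsionBy A.geomPoints ((p ^ (n + 1) : ℕ) : ℤ) →+ torsionBy A.geomPoints ((p : ℕ) : ℤ) :=
      { toFun := fun x => ⟨(p ^ n : ℕ) • (x : A.geomPoints), by
          rw [torsionBy.nsmul_iff, smul_smul, ← pow_succ']
          exact torsionBy.nsmul_iff.mp x.2⟩
        map_zero' := by ext; simp
        map_add' := fun x y => by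
          ext
          change (p ^ n : ℕ) • ((x : A.geomPoints) + (y : A.geomPoints)) =
            (p ^ n : ℕ) • (x : A.geomPoints) + (p ^ n : ℕ) • (y : A.geomPoints)
          exact smul_add _ _ _ }
    -- `ψ` is onto
    have hsurj : Function.Surjective ψ := by
      intro y
      obtain ⟨a, ha⟩ := zsmul_surjective_geomPoints A (n := ((p ^ n : ℕ) : ℤ)) (by exact_mod_cast pow_ne_zero n hp.out.ne_zero)
        (y : A.geomPoints)
      have ha' : (p ^ n : ℕ) • a = (y : A.geomPoints) := by rw [← natCast_zsmul]; exact ha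
      refine ⟨⟨a, ?_⟩, Subtype.ext ha'⟩
      rw [torsionBy.nsmul_iff, pow_succ', mul_smul, ha']
      exact torsionBy.nsmul_iff.mp y.2
    -- `ker ψ = A[p^n]`
    have hker : Nat.card ψ.ker = Nat.card (torsionBy A.geomPoints ((p ^ n : ℕ) : ℤ)) := by
      refine Nat.card_congr
        { toFun := fun x => ⟨((x : torsionBy A.geomPoints _) : A.geomPoints), by
            rw [torsionBy.nsmul_iff]
            exact congrArg Subtype.val ((AddMonoidHom.mem_ker).mp x.2)⟩
          invFun := fun y => ⟨⟨(y : A.geomPoints), by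
              rw [torsionBy.nsmul_iff, pow_succ', mul_smul, torsionBy.nsmul_iff.mp y.2, smul_zero]⟩,
            (AddMonoidHom.mem_ker).mpr (Subtype.ext (torsionBy.nsmul_iff.mp y.2))⟩
          left_inv := fun x => rfl
          right_inv := fun y => rfl }
    have hrange : Nat.card ψ.range = Nat.card (torsionBy A.geomPoints ((p : ℕ) : ℤ)) := by
      rw [AddMonoidHom.range_eq_top_of_surjective _ hsurj, AddSubgroup.card_top]
    rw [AddSubgroup.card_eq_card_quotient_mul_card_addSubgroup ψ.ker,
      Nat.card_congr (QuotientAddGroup.quotientKerEquivRange ψ).toEquiv, hrange, hker, hr, ih]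
    ring

end PTorsion

/-! ### A good family of integer polynomials from a monic one -/

section GoodFamily

open Polynomial Literature.Algebra.Polynomial.RootRigidity UniqueFactorizationMonoid

omit [Field K] in
/-- **Distinct irreducible factors.** A monic `m₀ ∈ ℤ[X]` factors over `ℚ` as `∏_j m_j^{a_j}` with
`m_j ∈ ℤ[X]` monic, irreducible and pairwise distinct (an `IsGoodFamily`): the normalized irreducible
factors over `ℚ`, which have integer coefficients (Gauss, Mathlib `IsIntegrallyClosed.eq_map_mul_C_of_dvd`).
[folklore] -/
theorem exists_isGoodFamily_of_monic {m₀ : ℤ[X]} (hm₀ : m₀.Monic) :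
    ∃ (J : Type) (_ : Fintype J) (m : J → ℤ[X]) (a : J → ℕ), IsGoodFamily m ∧
      m₀.map (algebraMap ℤ ℚ) = ∏ j, ((m j).map (algebraMap ℤ ℚ)) ^ a j := by
  classical
  set f := m₀.map (algebraMap ℤ ℚ) with hf
  have hfm : f.Monic := hm₀.map _
  set NF := normalizedFactors f with hNF
  have hmem : ∀ g ∈ NF, Irreducible g ∧ g.Monic ∧ g ∣ f := fun g hg => by
    refine ⟨irreducible_of_normalized_factor g hg, ?_, dvd_of_mem_normalizedFactors hg⟩
    rw [← normalize_normalized_factor g hg]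
    exact Polynomial.monic_normalize (irreducible_of_normalized_factor g hg).ne_zero
  have hlift : ∀ g ∈ NF, ∃ g' : ℤ[X], g'.map (algebraMap ℤ ℚ) = g := fun g hg => by
    obtain ⟨g', hg'⟩ := IsIntegrallyClosed.eq_map_mul_C_of_dvd ℚ hm₀ (hmem g hg).2.2
    refine ⟨g', ?_⟩
    rw [(hmem g hg).2.1.leadingCoeff, C_1, mul_one] at hg'
    exact hg'
  choose! lift hlift using hlift
  have hinj : Function.Injective (algebraMap ℤ ℚ) := (algebraMap ℤ ℚ).injective_int
  have hmonic : ∀ j : ↥NF.toFinset, (lift j).Monic := fun j => by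
    have h := (hmem j (Multiset.mem_toFinset.mp j.2)).2.1
    rw [← hlift j (Multiset.mem_toFinset.mp j.2)] at h
    exact monic_of_injective hinj h
  refine ⟨↥NF.toFinset, inferInstance, fun j => lift j, fun j => NF.count (j : ℚ[X]), ⟨hmonic, ?_, ?_⟩, ?_⟩
  · intro j
    refine ((hmonic j).irreducible_iff_irreducible_map_fraction_map (K := ℚ)).2 ?_
    rw [hlift j (Multiset.mem_toFinset.mp j.2)]
    exact (hmem j (Multiset.mem_toFinset.mp j.2)).1
  · intro i j hij
    apply Subtype.ext
    rw [← hlift i (Multiset.mem_toFinset.mp i.2), ← hlift j (Multiset.mem_toFinset.mp j.2)]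
    exact congrArg _ hij
  · have hprod : NF.prod = ∏ j : ↥NF.toFinset, ((lift j).map (algebraMap ℤ ℚ)) ^ NF.count (j : ℚ[X]) := by
      rw [Finset.prod_multiset_count, ← Finset.prod_coe_sort]
      refine Finset.prod_congr rfl fun j _ => ?_
      rw [hlift j (Multiset.mem_toFinset.mp j.2)]
    have hassoc : Associated NF.prod f := prod_normalizedFactors hfm.ne_zero
    have hpm : NF.prod.Monic := by
      rw [hprod]
      exact monic_prod_of_monic _ _ fun j _ => ((hmonic j).map _).pow _
    rw [← hprod]
    exact (eq_of_monic_of_associated hpm hfm hassoc).symm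

end GoodFamily

/-! ### Kernel counts at one and two primes -/

section KernelCounts

open Hom Literature.NumberTheory.DiophantineGeometry

variable {A : AbelianVariety K}

/-- The `ℓ`-power-torsion part of the kernel of an isogeny on geometric points is finite. [folklore] -/
theorem finite_setOf_primary_ker_of_isIsogeny {u : A ⟶ A} (hu : IsIsogeny u) (ℓ : ℕ) :
    {a : A.geomPoints | (∃ n : ℕ, ℓ ^ n • a = 0) ∧ geomPointsMap u a = 0}.Finite := by
  haveI := hu.finite_ker_geomPointsMap
  have hfin : {a : A.geomPoints | geomPointsMap u a = 0}.Finite :=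
    (Set.toFinite ((geomPointsMap u).ker : Set A.geomPoints)).subset fun a ha => (AddMonoidHom.mem_ker).mpr ha
  exact hfin.subset fun a ha => ha.2

/-- **`#S_ℓ(u) ≤ deg u`**: the `ℓ`-primary part of `Ker u (K̄)` has at most `#Ker u (K̄) ≤ kerRank u` elements.
[folklore] -/
theorem natCard_setOf_primary_ker_le_kerRank {u : A ⟶ A} (hu : IsIsogeny u) (ℓ : ℕ) [Fact ℓ.Prime] :
    Nat.card {a : A.geomPoints | (∃ n : ℕ, ℓ ^ n • a = 0) ∧ geomPointsMap u a = 0} ≤ Hom.kerRank u := by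
  haveI := hu.2
  haveI : Finite (kerPoints (specOver K (AlgebraicClosure K)) u) :=
    finite_kerPoints_of_isFinite u (AlgebraicClosure K)
  rw [natCard_setOf_primary_ker_eq u ℓ]
  have hN : 0 < Nat.card (kerPoints (specOver K (AlgebraicClosure K)) u) := Nat.card_pos
  exact (Nat.le_of_dvd hN (Nat.ordProj_dvd _ _)).trans (natCard_kerPoints_le_kerRank u (AlgebraicClosure K))

/-- **`#S_{ℓ₁}(u) · #S_{ℓ₂}(u) ≤ deg u`** for distinct primes `ℓ₁ ≠ ℓ₂`: the two primary parts of the finite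
group `Ker u (K̄)` have coprime orders dividing `#Ker u (K̄) ≤ kerRank u`. [folklore] -/
theorem natCard_setOf_primary_ker_mul_le_kerRank {u : A ⟶ A} (hu : IsIsogeny u) {ℓ₁ ℓ₂ : ℕ}
    [h₁ : Fact ℓ₁.Prime] [h₂ : Fact ℓ₂.Prime] (hne : ℓ₁ ≠ ℓ₂) :
    Nat.card {a : A.geomPoints | (∃ n : ℕ, ℓ₁ ^ n • a = 0) ∧ geomPointsMap u a = 0} *
        Nat.card {a : A.geomPoints | (∃ n : ℕ, ℓ₂ ^ n • a = 0) ∧ geomPointsMap u a = 0} ≤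
      Hom.kerRank u := by
  haveI := hu.2
  haveI : Finite (kerPoints (specOver K (AlgebraicClosure K)) u) :=
    finite_kerPoints_of_isFinite u (AlgebraicClosure K)
  rw [natCard_setOf_primary_ker_eq u ℓ₁, natCard_setOf_primary_ker_eq u ℓ₂]
  set N := Nat.card (kerPoints (specOver K (AlgebraicClosure K)) u) with hN
  have hN0 : 0 < N := Nat.card_pos
  have hdvd : ℓ₁ ^ N.factorization ℓ₁ * ℓ₂ ^ N.factorization ℓ₂ ∣ N :=
    Nat.Coprime.mul_dvd_of_dvd_of_dvd (Nat.coprime_pow_primes _ _ h₁.out h₂.out hne)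
      (Nat.ordProj_dvd N ℓ₁) (Nat.ordProj_dvd N ℓ₂)
  exact (Nat.le_of_dvd hN0 hdvd).trans (natCard_kerPoints_le_kerRank u (AlgebraicClosure K))

end KernelCounts

/-! ### Isogenies in `ℤ[π]` by Bézout, and the coprimality of the test polynomials -/

section Bezout

open Polynomial Hom Literature.Algebra.Polynomial.RootRigidity

variable [Finite K] (A : AbelianVariety K)

/-- **`F(π)` is an isogeny when `F` is coprime over `ℚ` to a polynomial killing `π`**: Bézout with cleared
denominators gives `G F + H m₀ = c ≠ 0` in `ℤ[X]`, so `G(π) ∘ F(π) = [c]` is an isogeny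
(`isIsogeny_zsmul_id_holds`), whence `F(π)` is surjective, hence an isogeny (`isIsogeny_of_surjective_end`).
[folklore] -/
theorem isIsogeny_aeval_frobeniusHom_of_isCoprime {m₀ F : ℤ[X]}
    (hm₀ : (aeval (End.of (frobeniusHom A)) m₀ : End A) = 0)
    (hcop : IsCoprime (F.map (algebraMap ℤ ℚ)) (m₀.map (algebraMap ℤ ℚ))) :
    IsIsogeny ((aeval (End.of (frobeniusHom A)) F : End A) : A ⟶ A) := by
  set π := End.of (frobeniusHom A) with hπ
  obtain ⟨a, b, hab⟩ := hcop
  obtain ⟨ρ, hρM, hρ⟩ := IsLocalization.integerNormalization_spec (nonZeroDivisors ℤ) a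
  obtain ⟨σ, hσM, hσ⟩ := IsLocalization.integerNormalization_spec (nonZeroDivisors ℤ) b
  set a' := IsLocalization.integerNormalization (nonZeroDivisors ℤ) a with ha'
  set b' := IsLocalization.integerNormalization (nonZeroDivisors ℤ) b with hb'
  have hρ0 : (ρ : ℤ) ≠ 0 := nonZeroDivisors.ne_zero hρM
  have hσ0 : (σ : ℤ) ≠ 0 := nonZeroDivisors.ne_zero hσM
  -- `(σ a') F + (ρ b') m₀ = ρ σ` in `ℤ[X]`
  have hid : (C σ * a') * F + (C ρ * b') * m₀ = C (ρ * σ) := by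
    apply Polynomial.map_injective (algebraMap ℤ ℚ) (algebraMap ℤ ℚ).injective_int
    simp only [Polynomial.map_add, Polynomial.map_mul, Polynomial.map_C, hρ, hσ, zsmul_eq_mul]
    have h1 : (algebraMap ℤ ℚ) (ρ * σ) = ((ρ : ℤ) : ℚ) * ((σ : ℤ) : ℚ) := by push_cast; rfl
    rw [h1, C_mul]
    have h2 : (algebraMap ℤ ℚ) σ = ((σ : ℤ) : ℚ) := rfl
    have h3 : (algebraMap ℤ ℚ) ρ = ((ρ : ℤ) : ℚ) := rfl
    rw [h2, h3, ← C_eq_intCast, ← C_eq_intCast]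
    linear_combination (C ((ρ : ℤ) : ℚ) * C ((σ : ℤ) : ℚ)) * hab
  -- evaluate at `π`
  set G := C σ * a' with hG
  have hev := congrArg (aeval π) hid
  rw [map_add, map_mul, map_mul (aeval π) _ m₀, hm₀, mul_zero, add_zero, Polynomial.aeval_C] at hev
  have hev' : (aeval π F : End A) * aeval π G = algebraMap ℤ (End A) (ρ * σ) := by
    rw [← map_mul, mul_comm, map_mul]; exact hev
  have hc : IsIsogeny ((algebraMap ℤ (End A) (ρ * σ) : End A) : A ⟶ A) := by
    have h : ((algebraMap ℤ (End A) (ρ * σ) : End A) : A ⟶ A) = (ρ * σ) • 𝟙 A := by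
      rw [Algebra.algebraMap_eq_smul_one]; rfl
    rw [h]
    exact isIsogeny_zsmul_id_holds A _ (mul_ne_zero hρ0 hσ0)
  have hiso : IsIsogeny (((aeval π G : End A) : A ⟶ A) ≫ ((aeval π F : End A) : A ⟶ A)) := by
    rw [← End.mul_def, hev']; exact hc
  haveI : Surjective (Hom.toSchemeHom ((aeval π G : End A) : A ⟶ A) ≫
      Hom.toSchemeHom ((aeval π F : End A) : A ⟶ A)) := by
    rw [← toSchemeHom_comp]; exact hiso.1
  haveI := Surjective.of_comp (Hom.toSchemeHom ((aeval π G : End A) : A ⟶ A))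
    (Hom.toSchemeHom ((aeval π F : End A) : A ⟶ A))
  exact isIsogeny_of_surjective_end _

omit [Finite K] in
/-- An integer polynomial divisible by no `m_j` is coprime over `ℚ` to `∏_j m_j^{a_j}` (the `m_j` being
irreducible over `ℚ` and monic). [folklore] -/
theorem isCoprime_map_prod_pow_of_forall_not_dvd {J : Type*} [Fintype J] {m : J → ℤ[X]} (hm : IsGoodFamily m)
    (a : J → ℕ) {F : ℤ[X]} (hF : ∀ j, ¬ m j ∣ F) :
    IsCoprime (F.map (algebraMap ℤ ℚ)) (∏ j, ((m j).map (algebraMap ℤ ℚ)) ^ a j) := by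
  refine IsCoprime.prod_right fun j _ => IsCoprime.pow_right ?_
  refine ((hm.irreducible_map j).coprime_iff_not_dvd.2 fun hdvd => hF j ?_).symm
  exact (Polynomial.map_dvd_map (algebraMap ℤ ℚ) (algebraMap ℤ ℚ).injective_int (hm.monic j)).1 hdvd

end Bezout

/-! ### The rigidity package for the Frobenius -/

section Main

open Polynomial Hom Literature.Algebra.Polynomial.RootRigidity Literature.NumberTheory.EllipticCurves
  Literature.NumberTheory.DiophantineGeometry AddSubgroup

variable [Finite K] (A : AbelianVariety K)

/-- **The algebraic data of `ℤ[π]`.**  There are monic irreducible pairwise distinct `m_j ∈ ℤ[X]` and a monic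
`m₀ ∈ ℤ[X]` killing `π` (the minimal polynomial of `π` over `ℤ`; `End A` is finitely generated,
`module_finite_hom_holds`) whose roots in every field of characteristic `0` are roots of the `m_j`, such that
`F(π)` is an isogeny for every integer `F` divisible by no `m_j` (Bézout), and the cube bound
`deg F(π) ≤ C(r) H(F)^{2 dim A}` holds for `F` of degree `< r`. [folklore] -/
theorem exists_isGoodFamily_frobeniusHom (hA : 0 < A.dim) :
    ∃ (J : Type) (_ : Fintype J) (m : J → ℤ[X]) (m₀ : ℤ[X]), IsGoodFamily m ∧
      (aeval (A := AddMonoid.End A.geomPoints) (geomPointsMap (frobeniusHom A)) m₀ : AddMonoid.End _) = 0 ∧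
      (∀ (L : Type) [Field L] [CharZero L] (b : L), aeval b m₀ = 0 → ∃ j, aeval b (m j) = 0) ∧
      (∀ F : ℤ[X], (∀ j, ¬ m j ∣ F) → IsIsogeny ((aeval (End.of (frobeniusHom A)) F : End A) : A ⟶ A)) ∧
      (∀ r : ℕ, ∃ C : ℝ, ∀ F : ℤ[X], F.natDegree < r →
        IsIsogeny ((aeval (End.of (frobeniusHom A)) F : End A) : A ⟶ A) →
          (Hom.kerRank ((aeval (End.of (frobeniusHom A)) F : End A) : A ⟶ A) : ℝ) ≤
            C * (height F : ℝ) ^ (2 * A.dim)) := by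
  classical
  set π := End.of (frobeniusHom A) with hπ
  -- `π` is integral over `ℤ` (`End A` is a finitely generated abelian group)
  have hint : IsIntegral ℤ π := by
    have h : Module.Finite ℤ (A ⟶ A) := module_finite_hom_holds A A
    have e : (Algebra.toModule : Module ℤ (End A)) = AddCommGroup.toIntModule (A ⟶ A) :=
      Subsingleton.elim _ _
    haveI : @Module.Finite ℤ (End A) _ _ Algebra.toModule := by rw [e]; exact h
    exact Algebra.IsIntegral.isIntegral (R := ℤ) π
  set m₀ := minpoly ℤ π with hm₀def
  have hm₀m : m₀.Monic := minpoly.monic hint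
  have hm₀π : (aeval π m₀ : End A) = 0 := minpoly.aeval ℤ π
  obtain ⟨J, _, m, a, hm, hfac⟩ := exists_isGoodFamily_of_monic hm₀m
  refine ⟨J, inferInstance, m, m₀, hm, ?_, ?_, ?_, ?_⟩
  · -- `m₀(φ) = 0` on geometric points
    rw [← geomPointsMap_aeval, hm₀π]
    exact geomPointsMap_zero
  · -- roots of `m₀` are roots of the `m_j`
    intro L _ _ b hb
    have h1 : aeval b (m₀.map (algebraMap ℤ ℚ)) = 0 := by rw [aeval_map_algebraMap]; exact hb
    rw [hfac, map_prod, Finset.prod_eq_zero_iff] at h1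
    obtain ⟨j, -, hj⟩ := h1
    refine ⟨j, ?_⟩
    rw [map_pow] at hj
    have h2 := pow_eq_zero_iff' .. |>.mp hj
    rw [aeval_map_algebraMap] at h2
    exact h2.1
  · -- Bézout
    intro F hF
    refine isIsogeny_aeval_frobeniusHom_of_isCoprime A hm₀π ?_
    rw [hfac]
    exact isCoprime_map_prod_pow_of_forall_not_dvd hm a hF
  · -- the cube bound
    intro r
    obtain ⟨C, hC⟩ := exists_kerRank_aeval_frobeniusHom_le A hA r
    refine ⟨max (C : ℝ) 0 * (r : ℝ) ^ (2 * A.dim), fun F hF hiso => ?_⟩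
    have h := hC F hF hiso
    -- `∑ |F_i| ≤ r H(F)`
    have hcoef : (∑ i ∈ Finset.range r, |F.coeff i| : ℤ) ≤ r * height F := by
      calc (∑ i ∈ Finset.range r, |F.coeff i| : ℤ) ≤ ∑ _i ∈ Finset.range r, (height F : ℤ) :=
            Finset.sum_le_sum fun i _ => by
              rw [Int.abs_eq_natAbs]; exact_mod_cast natAbs_coeff_le_height F i
        _ = r * height F := by rw [Finset.sum_const, Finset.card_range]; simp
    have h0 : (0 : ℤ) ≤ ∑ i ∈ Finset.range r, |F.coeff i| := Finset.sum_nonneg fun i _ => abs_nonneg _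
    have h2 : (Hom.kerRank ((aeval π F : End A) : A ⟶ A) : ℤ) ≤ max C 0 * ((r : ℤ) * height F) ^ (2 * A.dim) :=
      calc (Hom.kerRank ((aeval π F : End A) : A ⟶ A) : ℤ)
            ≤ C * (∑ i ∈ Finset.range r, |F.coeff i|) ^ (2 * A.dim) := h
        _ ≤ max C 0 * (∑ i ∈ Finset.range r, |F.coeff i|) ^ (2 * A.dim) :=
            mul_le_mul_of_nonneg_right (le_max_left _ _) (by positivity)
        _ ≤ max C 0 * ((r : ℤ) * height F) ^ (2 * A.dim) :=
            mul_le_mul_of_nonneg_left (pow_le_pow_left₀ h0 hcoef _) (le_max_right _ _)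
    have h3 : ((Hom.kerRank ((aeval π F : End A) : A ⟶ A) : ℤ) : ℝ) ≤
        ((max C 0 * ((r : ℤ) * height F) ^ (2 * A.dim) : ℤ) : ℝ) := by exact_mod_cast h2
    push_cast at h3
    calc (Hom.kerRank ((aeval π F : End A) : A ⟶ A) : ℝ)
          ≤ max (C : ℝ) 0 * ((r : ℝ) * height F) ^ (2 * A.dim) := h3
      _ = max (C : ℝ) 0 * (r : ℝ) ^ (2 * A.dim) * (height F : ℝ) ^ (2 * A.dim) := by ring

/-- **Rigidity package for the Frobenius of an abelian variety over a finite field** (Weil; Mumford §19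
Thm. 4 with §21, Milne 1986 Thm. 19.1 (a) — here WITHOUT the polynomiality of `deg`, Mumford §19 Thm. 2).
Let `A` be an abelian variety of dimension `g > 0` over a finite field `K` of characteristic `p`, `π` its
Frobenius, and `S_ℓ(F) = {a ∈ A(K̄)[ℓ^∞] | F(π) a = 0}`.  There is a monic `P ∈ ℤ[X]` of degree `2g` with:
* for every prime `ℓ ≠ p`, **`charpoly (π | T_ℓ A) = P`**;
* for every prime `ℓ ≠ p` and every `F ∈ ℤ[X]` with `F(π)` an isogeny, `#S_ℓ(F) = ∏_{P(β)=0} |F(β)|_ℓ⁻¹`;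
* at `p`: a monic `Q_p ∈ ℤ_p[X]` (the characteristic polynomial of `π` on the `p`-adic Tate module of
  `A(K̄)`) whose roots, with multiplicity, form a sub-multiset of the roots of `P` in `\overline{ℚ_p}`, with
  `#S_p(F) = ∏_{Q_p(γ)=0} |F(γ)|_p⁻¹` for the same `F`.
Proof: `TateModule.charpoly_map_eq_prod_pow_of_kernelBound(₂)` /
`rootMultiplicity_charpoly_map_le_of_kernelBound` for `A(K̄)` and `φ = π`, with the good family of
`exists_isGoodFamily_frobeniusHom`, the kernel bound `#S_{ℓ₁}(F) · #S_{ℓ₂}(F) ≤ #Ker F(π)(K̄) ≤ deg F(π)`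
(`natCard_setOf_primary_ker_mul_le_kerRank`) and the cube bound; `#A[ℓ^n](K̄) = ℓ^{2gn}`
(`natCard_geomTorsion_pow'`) resp. `= p^{rn}` (`exists_natCard_geomTorsion_prime_pow`).
[cite: MumfordAV1970, §19 Thm. 4 and §21] [cite: Milne1986AbelianVarieties, §19 Thm. 19.1 (a)] -/
theorem exists_charpoly_frobenius_package (hA : 0 < A.dim) (p : ℕ) [hp : Fact p.Prime] [CharP K p] :
    ∃ P : ℤ[X], P.Monic ∧ P.natDegree = 2 * A.dim ∧
      (∀ (ℓ : ℕ) [Fact ℓ.Prime] [Module.Free ℤ_[ℓ] (A.tateModule ℓ)] [Module.Finite ℤ_[ℓ] (A.tateModule ℓ)],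
          ℓ ≠ p → (tateModuleMap ℓ (frobeniusHom A)).charpoly = P.map (Int.castRingHom ℤ_[ℓ])) ∧
      (∀ (ℓ : ℕ) [Fact ℓ.Prime], ℓ ≠ p → ∀ F : ℤ[X],
          IsIsogeny ((aeval (End.of (frobeniusHom A)) F : End A) : A ⟶ A) →
          {a : A.geomPoints | (∃ n : ℕ, ℓ ^ n • a = 0) ∧
              (aeval (A := AddMonoid.End A.geomPoints) (geomPointsMap (frobeniusHom A)) F) a = 0}.Finite ∧
            (Nat.card {a : A.geomPoints | (∃ n : ℕ, ℓ ^ n • a = 0) ∧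
              (aeval (A := AddMonoid.End A.geomPoints) (geomPointsMap (frobeniusHom A)) F) a = 0} : ℝ) =
              kerNorm (P.map (Int.castRingHom ℤ_[ℓ])) F) ∧
      (∃ Qp : ℤ_[p][X], Qp.Monic ∧
          (Qp.map (algebraMap ℤ_[p] (PadicAlgCl p))).roots ≤
            ((P.map (Int.castRingHom ℤ_[p])).map (algebraMap ℤ_[p] (PadicAlgCl p))).roots ∧
          ∀ F : ℤ[X], IsIsogeny ((aeval (End.of (frobeniusHom A)) F : End A) : A ⟶ A) →
            {a : A.geomPoints | (∃ n : ℕ, p ^ n • a = 0) ∧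
                (aeval (A := AddMonoid.End A.geomPoints) (geomPointsMap (frobeniusHom A)) F) a = 0}.Finite ∧
              (Nat.card {a : A.geomPoints | (∃ n : ℕ, p ^ n • a = 0) ∧
                (aeval (A := AddMonoid.End A.geomPoints) (geomPointsMap (frobeniusHom A)) F) a = 0} : ℝ) =
                kerNorm Qp F) := by
  classical
  obtain ⟨J, _, m, m₀, hm, hm₀φ, hm₀J, hisoF, hBnd⟩ := exists_isGoodFamily_frobeniusHom A hA
  set φ : AddMonoid.End A.geomPoints := geomPointsMap (frobeniusHom A) with hφ
  -- kernel sets: finiteness and counts for isogenies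
  have hset : ∀ (ℓ : ℕ) (F : ℤ[X]),
      {a : A.geomPoints | (∃ n : ℕ, ℓ ^ n • a = 0) ∧ (aeval φ F : AddMonoid.End A.geomPoints) a = 0} =
        {a : A.geomPoints | (∃ n : ℕ, ℓ ^ n • a = 0) ∧
          geomPointsMap ((aeval (End.of (frobeniusHom A)) F : End A) : A ⟶ A) a = 0} := fun ℓ F =>
    congrArg (fun ψ : AddMonoid.End A.geomPoints =>
      {a : A.geomPoints | (∃ n : ℕ, ℓ ^ n • a = 0) ∧ ψ a = 0}) (geomPointsMap_aeval (End.of (frobeniusHom A)) F).symm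
  have hS : ∀ (ℓ : ℕ) [Fact ℓ.Prime] (F : ℤ[X]),
      IsIsogeny ((aeval (End.of (frobeniusHom A)) F : End A) : A ⟶ A) →
      {a : A.geomPoints | (∃ n : ℕ, ℓ ^ n • a = 0) ∧ (aeval φ F : AddMonoid.End A.geomPoints) a = 0}.Finite ∧
        (Nat.card {a : A.geomPoints | (∃ n : ℕ, ℓ ^ n • a = 0) ∧
          (aeval φ F : AddMonoid.End A.geomPoints) a = 0} : ℝ) ≤
          Hom.kerRank ((aeval (End.of (frobeniusHom A)) F : End A) : A ⟶ A) := by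
    intro ℓ _ F hF
    rw [hset]
    exact ⟨finite_setOf_primary_ker_of_isIsogeny hF ℓ,
      by exact_mod_cast natCard_setOf_primary_ker_le_kerRank hF ℓ⟩
  have hS₂ : ∀ (ℓ₁ ℓ₂ : ℕ) [Fact ℓ₁.Prime] [Fact ℓ₂.Prime], ℓ₁ ≠ ℓ₂ → ∀ F : ℤ[X],
      IsIsogeny ((aeval (End.of (frobeniusHom A)) F : End A) : A ⟶ A) →
      {a : A.geomPoints | (∃ n : ℕ, ℓ₁ ^ n • a = 0) ∧ (aeval φ F : AddMonoid.End A.geomPoints) a = 0}.Finite ∧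
      {a : A.geomPoints | (∃ n : ℕ, ℓ₂ ^ n • a = 0) ∧ (aeval φ F : AddMonoid.End A.geomPoints) a = 0}.Finite ∧
        (Nat.card {a : A.geomPoints | (∃ n : ℕ, ℓ₁ ^ n • a = 0) ∧
            (aeval φ F : AddMonoid.End A.geomPoints) a = 0} : ℝ) *
          Nat.card {a : A.geomPoints | (∃ n : ℕ, ℓ₂ ^ n • a = 0) ∧
            (aeval φ F : AddMonoid.End A.geomPoints) a = 0} ≤
          Hom.kerRank ((aeval (End.of (frobeniusHom A)) F : End A) : A ⟶ A) := by
    intro ℓ₁ ℓ₂ _ _ hne F hF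
    rw [hset, hset]
    exact ⟨finite_setOf_primary_ker_of_isIsogeny hF ℓ₁, finite_setOf_primary_ker_of_isIsogeny hF ℓ₂,
      by exact_mod_cast natCard_setOf_primary_ker_mul_le_kerRank hF hne⟩
  -- an auxiliary prime `ℓ₀ ≠ p`
  obtain ⟨ℓ₀, hℓ₀p, hℓ₀⟩ := Nat.exists_infinite_primes (p + 1)
  haveI : Fact ℓ₀.Prime := ⟨hℓ₀⟩
  have hne₀ : ℓ₀ ≠ p := by omega
  have hcast : ∀ ℓ : ℕ, ℓ.Prime → ℓ ≠ p → (ℓ : K) ≠ 0 := fun ℓ hℓ hne h =>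
    hne ((Nat.prime_dvd_prime_iff_eq hp.out hℓ).mp ((CharP.cast_eq_zero_iff K p ℓ).mp h)).symm
  have hcard : ∀ (ℓ : ℕ) [Fact ℓ.Prime], ℓ ≠ p →
      ∀ n, Nat.card (torsionBy A.geomPoints (ℓ ^ n : ℕ)) = ℓ ^ ((2 * A.dim) * n) :=
    fun ℓ _ hne => natCard_geomTorsion_pow_tate ℓ (hcast ℓ Fact.out hne)
  -- the degree function and its bound
  set N : ℤ[X] → ℝ := fun F => (Hom.kerRank ((aeval (End.of (frobeniusHom A)) F : End A) : A ⟶ A) : ℝ)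
    with hN
  have hB : ∀ r : ℕ, ∃ C : ℝ, ∀ F : ℤ[X], F.natDegree < r → (∀ j, ¬ m j ∣ F) →
      N F ≤ C * (height F : ℝ) ^ (2 * A.dim) := by
    intro r
    obtain ⟨C, hC⟩ := hBnd r
    exact ⟨C, fun F hF hFm => hC F hF (hisoF F hFm)⟩
  -- one prime: `ℓ₀`
  haveI := TateModule.free_of_card_torsionBy_rank (hcard ℓ₀ hne₀)
  haveI := TateModule.finite_of_card_torsionBy_rank (hcard ℓ₀ hne₀)
  obtain ⟨n, hQ₀, hsum, -⟩ := TateModule.charpoly_map_eq_prod_pow_of_kernelBound (hcard ℓ₀ hne₀) φ hm hm₀φ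
    (fun b hb => hm₀J (PadicAlgCl ℓ₀) b hb) N (fun F hFm => hS ℓ₀ F (hisoF F hFm)) hB
  -- the polynomial `P`
  set P : ℤ[X] := ∏ j, m j ^ n j with hPdef
  have hPm : P.Monic := monic_prod_of_monic _ _ fun j _ => (hm.monic j).pow _
  have hPdeg : P.natDegree = 2 * A.dim := by
    rw [hPdef, natDegree_prod_of_monic _ _ fun j _ => (hm.monic j).pow _, ← hsum]
    exact Finset.sum_congr rfl fun j _ => natDegree_pow _ _
  have hPmap : ∀ (R : Type) [CommRing R],
      P.map (Int.castRingHom R) = ∏ j, ((m j).map (algebraMap ℤ R)) ^ n j := by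
    intro R _
    rw [hPdef, Polynomial.map_prod, ← algebraMap_int_eq]
    simp only [Polynomial.map_pow]
  -- the characteristic polynomial at every `ℓ ≠ p`
  have hchar : ∀ (ℓ : ℕ) [Fact ℓ.Prime] [Module.Free ℤ_[ℓ] (A.tateModule ℓ)] [Module.Finite ℤ_[ℓ] (A.tateModule ℓ)],
      ℓ ≠ p → (tateModuleMap ℓ (frobeniusHom A)).charpoly = P.map (Int.castRingHom ℤ_[ℓ]) := by
    intro ℓ _ _ _ hne
    rw [hPmap]
    by_cases hℓ₀ : ℓ = ℓ₀
    · subst hℓ₀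
      exact hQ₀
    · exact TateModule.charpoly_map_eq_prod_pow_of_kernelBound₂ (p := ℓ₀) (q := ℓ) (hcard ℓ₀ hne₀)
        (hcard ℓ hne) φ hm hm₀φ (fun b hb => hm₀J (PadicAlgCl ℓ) b hb) hQ₀ hsum N
        (fun F hFm => hS₂ ℓ₀ ℓ (Ne.symm hℓ₀) F (hisoF F hFm)) hB
  refine ⟨P, hPm, hPdeg, hchar, ?_, ?_⟩
  · -- kernel counts at `ℓ ≠ p`
    intro ℓ _ hne F hF
    haveI := TateModule.free_of_card_torsionBy_rank (hcard ℓ hne)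
    haveI := TateModule.finite_of_card_torsionBy_rank (hcard ℓ hne)
    obtain ⟨hfin, -⟩ := hS ℓ F hF
    refine ⟨hfin, ?_⟩
    rw [← hchar ℓ hne]
    exact (TateModule.kerNorm_charpoly_map_eq_natCard (hcard ℓ hne) φ F hfin).symm
  · -- the prime `p`
    obtain ⟨r, hcardp⟩ := exists_natCard_geomTorsion_prime_pow A p
    haveI := TateModule.free_of_card_torsionBy_rank hcardp
    haveI := TateModule.finite_of_card_torsionBy_rank hcardp
    refine ⟨(TateModule.map p (φ : A.geomPoints →+ A.geomPoints)).charpoly, LinearMap.charpoly_monic _, ?_, ?_⟩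
    · -- domination of the roots
      have hmult : ∀ j, ∀ θ ∈ rts p m j,
          rootMultiplicity θ ((TateModule.map p (φ : A.geomPoints →+ A.geomPoints)).charpoly.map
            (algebraMap ℤ_[p] (PadicAlgCl p))) ≤ n j :=
        fun j θ hθ => TateModule.rootMultiplicity_charpoly_map_le_of_kernelBound (p := ℓ₀) (q := p)
          (hcard ℓ₀ hne₀) hcardp φ hm hm₀φ (fun b hb => hm₀J (PadicAlgCl p) b hb) hQ₀ hsum N
          (fun F hFm => hS₂ ℓ₀ p hne₀ F (hisoF F hFm)) hB j hθ
      rw [hPmap ℤ_[p], hm.roots_prod_pow n, Multiset.le_iff_count]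
      intro b
      by_cases hb : b ∈ ((TateModule.map p (φ : A.geomPoints →+ A.geomPoints)).charpoly.map
          (algebraMap ℤ_[p] (PadicAlgCl p))).roots
      · obtain ⟨j, hj⟩ : ∃ j, b ∈ rts p m j := by
          obtain ⟨j, hj⟩ := hm₀J (PadicAlgCl p) b
            (TateModule.aeval_eq_zero_of_mem_roots_charpoly_map φ hm₀φ hb)
          exact ⟨j, hm.mem_rts_iff.2 hj⟩
        have hR : Multiset.count b (∑ i, n i • rts p m i) = n j := by
          rw [Multiset.count_sum', Finset.sum_eq_single j]
          · rw [Multiset.count_nsmul, Multiset.count_eq_one_of_mem (hm.nodup_rts j) hj, mul_one]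
          · intro i _ hij
            rw [Multiset.count_nsmul, Multiset.count_eq_zero_of_notMem, mul_zero]
            exact fun hi => hij (hm.eq_of_mem_rts hi hj)
          · intro h; exact absurd (Finset.mem_univ j) h
        rw [hR, count_roots]
        exact hmult j b hj
      · rw [Multiset.count_eq_zero_of_notMem hb]
        exact Nat.zero_le _
    · intro F hF
      obtain ⟨hfin, -⟩ := hS p F hF
      exact ⟨hfin, (TateModule.kerNorm_charpoly_map_eq_natCard hcardp φ F hfin).symm⟩

/-- **Weil's theorem for the Frobenius, `ℓ`-adic form** (Mumford §19 Thm. 4 with §21; Milne 1986,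
Thm. 19.1 (a)): for an abelian variety `A` of positive dimension over a finite field of characteristic `p`
there is a monic `P ∈ ℤ[X]` of degree `2 dim A` which is the characteristic polynomial of the Frobenius on
`T_ℓ A` for EVERY prime `ℓ ≠ p`.  (Obtained here from the theorem of the cube by the rigidity of `p`-adic
root multiplicities, not via the polynomiality of `deg`; cf. `charpoly_tateModuleMap_frobeniusHom_eq` for
the latter route.) [cite: MumfordAV1970, §19 Thm. 4 and §21] [cite: Milne1986AbelianVarieties, §19 Thm. 19.1 (a)] -/
theorem exists_charpoly_tateModuleMap_frobeniusHom_eq_map (hA : 0 < A.dim) (p : ℕ) [Fact p.Prime] [CharP K p] :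
    ∃ P : ℤ[X], P.Monic ∧ P.natDegree = 2 * A.dim ∧
      ∀ (ℓ : ℕ) [Fact ℓ.Prime] [Module.Free ℤ_[ℓ] (A.tateModule ℓ)] [Module.Finite ℤ_[ℓ] (A.tateModule ℓ)],
        ℓ ≠ p → (tateModuleMap ℓ (frobeniusHom A)).charpoly = P.map (Int.castRingHom ℤ_[ℓ]) := by
  obtain ⟨P, hPm, hPdeg, hchar, -, -⟩ := exists_charpoly_frobenius_package A hA p
  exact ⟨P, hPm, hPdeg, hchar⟩


end Main

end AbelianVariety

end Literature.AlgebraicGeometry.Motives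

end
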